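import Summits.KontsevichZagierPeriods.KontsevichZagierPeriods.Theorems.MzvKernelInKZ.Negative.WeightFour

/-!
# `MzvKernelInKZ` (stmt-KontsevichZagierPeriods-3914): negative side — non-admissible words carry no representation

Companion of `Negative/WeightFour.lean`.  **Non-admissible words carry no representation.**  A word
whose first letter is `1` (form `dt/(1−t)` at the largest variable) or whose last letter is `0`
has a NON-integrable integrand on the simplex for every `q ≠ 0`: slicing along the largest
variable (`KZ.MZVSimplex.wordLIntegral_cons`, Tonelli) bounds the lower Lebesgue integral below by
`vol(Δⁿ(½)) · ∫_{½}^{1} dt/(1−t) = ∞`; the last-letter case is the first-letter case of the dual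
word through the duality involution.  So every generator of the crux with non-admissible letters
has `q = 0`, is a zero representation, hence a relation — the junk part of the generating set is
formally absorbed: `WeightKernel w ↔ WeightKernelAdm w`, and the cards' `WeightKernel 2`,
`WeightKernel 3` hold verbatim while `WeightKernel 4 ⟺ cFds4 ∧ cEuler4 ∈ relations`.

Sources: M. Kontsevich, D. Zagier, *Periods* (2001), §1.1 (convergence of the iterated integral
exactly for admissible words); D. Zagier (1994), §9. -/

noncomputable section

namespace Summit.KontsevichZagierPeriods.MzvKernelInKZ.Negative

open Set MeasureTheory MvPolynomial
open Literature.NumberTheory.Transcendental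
open Summit.KontsevichZagierPeriods.KontsevichZagierPeriods.Theses.LinRedNormalForm (MzvKernelInKZ)

section Divergence

open ENNReal

variable {w : ℕ}

/-- The ordered simplex below `x` is open. [folklore] -/
theorem isOpen_simplexLT (n : ℕ) (x : ℝ) :
    IsOpen {t : Fin n → ℝ | (∀ i, 0 < t i) ∧ (∀ i, t i < x) ∧ StrictAnti t} := by
  have h1 : IsOpen {t : Fin n → ℝ | ∀ i, 0 < t i} := by
    rw [Set.setOf_forall]
    exact isOpen_iInter_of_finite fun i => isOpen_lt continuous_const (continuous_apply i)
  have h2 : IsOpen {t : Fin n → ℝ | ∀ i, t i < x} := by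
    rw [Set.setOf_forall]
    exact isOpen_iInter_of_finite fun i => isOpen_lt (continuous_apply i) continuous_const
  have h3 : IsOpen {t : Fin n → ℝ | StrictAnti t} := by
    have : {t : Fin n → ℝ | StrictAnti t} = ⋂ i, ⋂ j, ⋂ (_ : i < j), {t | t j < t i} := by
      ext t; simp [StrictAnti]
    rw [this]
    exact isOpen_iInter_of_finite fun i => isOpen_iInter_of_finite fun j =>
      isOpen_iInter_of_finite fun _ => isOpen_lt (continuous_apply j) (continuous_apply i)
  have : {t : Fin n → ℝ | (∀ i, 0 < t i) ∧ (∀ i, t i < x) ∧ StrictAnti t} =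
      {t | ∀ i, 0 < t i} ∩ {t | ∀ i, t i < x} ∩ {t : Fin n → ℝ | StrictAnti t} := by
    ext t; simp [and_assoc]
  rw [this]
  exact (h1.inter h2).inter h3

/-- The half-size simplex `Δⁿ(½)` has positive Lebesgue measure (open and non-empty). [folklore] -/
theorem volume_simplexLT_half_ne_zero (n : ℕ) :
    volume {t : Fin n → ℝ | (∀ i, 0 < t i) ∧ (∀ i, t i < 1 / 2) ∧ StrictAnti t} ≠ 0 := by
  refine ((isOpen_simplexLT n (1 / 2)).measure_pos (μ := volume)
    ⟨fun i => 1 / (4 * ((i : ℝ) + 2)), ?_⟩).ne'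
  refine ⟨fun i => by positivity, fun i => ?_, fun i j hij => ?_⟩
  · have hi : (0 : ℝ) ≤ i := Nat.cast_nonneg _
    exact one_div_lt_one_div_of_lt (by norm_num) (by nlinarith)
  · have h : (i : ℝ) < j := by exact_mod_cast hij
    exact one_div_lt_one_div_of_lt (by positivity) (by nlinarith)

/-- `∫_{½}^{1} dt/(1−t) = ∞` (as a lower Lebesgue integral). [folklore] -/
theorem lintegral_inv_one_sub_eq_top :
    ∫⁻ t in Ioo (1 / 2 : ℝ) 1, ENNReal.ofReal (1 / (1 - t)) = ∞ := by
  by_contra hne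
  have hlt : ∫⁻ t in Ioo (1 / 2 : ℝ) 1, ENNReal.ofReal (1 / (1 - t)) < ∞ := lt_top_iff_ne_top.mpr hne
  have hmeas : Measurable fun t : ℝ => 1 / (1 - t) := measurable_const.div (measurable_const.sub measurable_id)
  have hint : IntegrableOn (fun t : ℝ => 1 / (1 - t)) (Ioo (1 / 2 : ℝ) 1) := by
    refine ⟨hmeas.aestronglyMeasurable, ?_⟩
    rw [hasFiniteIntegral_iff_ofReal]
    · exact hlt
    · exact (ae_restrict_iff' measurableSet_Ioo).mpr (ae_of_all _ fun t ht => by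
        have : 0 < 1 - t := by linarith [ht.2]
        positivity)
  have hint' : IntegrableOn (fun t : ℝ => (t - 1)⁻¹) (Ioo (1 / 2 : ℝ) 1) := by
    refine (hint.neg).congr_fun (fun t _ => ?_) measurableSet_Ioo
    simp only [Pi.neg_apply, one_div]
    rw [← inv_neg, neg_sub]
  have h := (intervalIntegrable_sub_inv_iff (a := (1 / 2 : ℝ)) (b := 1) (c := 1)).mp
    ((intervalIntegrable_iff_integrableOn_Ioo_of_le (by norm_num)).mpr hint')
  norm_num [Set.uIcc_of_le] at h

/-- **Divergence for a word starting with the letter `1`.** [folklore] -/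
theorem lintegral_word_true_cons_eq_top (L : List Bool) (n : ℕ) :
    ∫⁻ t in {t : Fin (n + 1) → ℝ | (∀ i, 0 < t i) ∧ (∀ i, t i < 1) ∧ StrictAnti t},
        ∏ i : Fin (n + 1), ENNReal.ofReal (KZ.mzvForm ((true :: L).getD i false) (t i)) = ∞ := by
  rw [KZ.MZVSimplex.wordLIntegral_cons]
  set H : Set (Fin n → ℝ) := {t | (∀ i, 0 < t i) ∧ (∀ i, t i < 1 / 2) ∧ StrictAnti t} with hH
  have hm := volume_simplexLT_half_ne_zero n
  -- lower bound of the inner integral on `t₀ > ½`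
  have hΛ : ∀ t₀ ∈ Ioo (1 / 2 : ℝ) 1, volume H ≤
      ∫⁻ t in {t : Fin n → ℝ | (∀ i, 0 < t i) ∧ (∀ i, t i < t₀) ∧ StrictAnti t},
        ∏ i : Fin n, ENNReal.ofReal (KZ.mzvForm (L.getD i false) (t i)) := by
    intro t₀ ht₀
    calc volume H = ∫⁻ _ in H, (1 : ℝ≥0∞) := by rw [setLIntegral_const, one_mul]
      _ ≤ ∫⁻ t in H, ∏ i : Fin n, ENNReal.ofReal (KZ.mzvForm (L.getD i false) (t i)) := by
          refine setLIntegral_mono' (KZ.MZVSimplex.measurableSet_simplexLT n (1 / 2)) fun t ht => ?_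
          refine Finset.one_le_prod' fun i _ => ENNReal.one_le_ofReal.mpr ?_
          have h0 : 0 < t i := ht.1 i
          have h1 : t i < 1 := (ht.2.1 i).trans (by norm_num)
          cases L.getD i false
          · rw [KZ.mzvForm_false, le_div_iff₀ h0]; linarith
          · rw [KZ.mzvForm_true, le_div_iff₀ (by linarith)]; linarith
      _ ≤ _ := by
          refine lintegral_mono_set fun t ht => ?_
          exact ⟨ht.1, fun i => (ht.2.1 i).trans ht₀.1, ht.2.2⟩
  refine top_unique ?_
  have hmeas : Measurable fun t₀ : ℝ => ENNReal.ofReal (1 / (1 - t₀)) :=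
    (measurable_const.div (measurable_const.sub measurable_id)).ennreal_ofReal
  calc (⊤ : ℝ≥0∞) = (∫⁻ t₀ in Ioo (1 / 2 : ℝ) 1, ENNReal.ofReal (1 / (1 - t₀))) * volume H := by
        rw [lintegral_inv_one_sub_eq_top, ENNReal.top_mul hm]
    _ = ∫⁻ t₀ in Ioo (1 / 2 : ℝ) 1, ENNReal.ofReal (1 / (1 - t₀)) * volume H :=
        (lintegral_mul_const _ hmeas).symm
    _ ≤ ∫⁻ t₀ in Ioo (1 / 2 : ℝ) 1, ENNReal.ofReal (KZ.mzvForm true t₀) *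
          ∫⁻ t in {t : Fin n → ℝ | (∀ i, 0 < t i) ∧ (∀ i, t i < t₀) ∧ StrictAnti t},
            ∏ i : Fin n, ENNReal.ofReal (KZ.mzvForm (L.getD i false) (t i)) := by
        refine setLIntegral_mono' measurableSet_Ioo fun t₀ ht₀ => ?_
        rw [KZ.mzvForm_true]
        exact mul_le_mul' le_rfl (hΛ t₀ ht₀)
    _ ≤ _ := lintegral_mono_set (Ioo_subset_Ioo (by norm_num) le_rfl)

/-- The simplex is Lebesgue measurable. [folklore] -/
theorem measurableSet_simplex (w : ℕ) : MeasurableSet (simplex w) :=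
  KZ.measurableSet_openOrderedSimplex w

/-- **No representation for a word starting with `1`**: `q · ∏ ω_ε` with `ε₀ = 1`, `q ≠ 0` is not
integrable on the simplex. [folklore] -/
theorem not_integrableOn_wordFun_of_head {n : ℕ} (ε : Fin (n + 1) → Bool) (h0 : ε 0 = true)
    {q : ℚ} (hq : q ≠ 0) : ¬ IntegrableOn (wordFun ε q) (simplex (n + 1)) volume := by
  intro hint
  have h1 : IntegrableOn (wordFun ε 1) (simplex (n + 1)) volume := by
    refine IntegrableOn.congr_fun (hint.const_mul ((q : ℝ)⁻¹)) (fun t _ => ?_)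
      (measurableSet_simplex _)
    have hq' : (q : ℝ) ≠ 0 := by exact_mod_cast hq
    rw [wordFun_eq_mul_wordFun_one ε q t, ← mul_assoc, inv_mul_cancel₀ hq', one_mul]
  have h2 := h1.lintegral_lt_top
  have h3 : ∫⁻ t in simplex (n + 1), ENNReal.ofReal (wordFun ε 1 t) =
      ∫⁻ t in simplex (n + 1), ∏ i : Fin (n + 1), ENNReal.ofReal
        (KZ.mzvForm ((true :: List.ofFn (fun j : Fin n => ε j.succ)).getD i false) (t i)) := by
    refine setLIntegral_congr_fun (measurableSet_simplex _) fun t ht => ?_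
    rw [wordFun_one_eq_prod_mzvForm,
      ENNReal.ofReal_prod_of_nonneg fun i _ => (KZ.mzvForm_pos _ (ht.1 i) (ht.2.1 i)).le]
    refine Finset.prod_congr rfl fun i _ => ?_
    congr 2
    induction i using Fin.cases with
    | zero => simp [h0]
    | succ j => simp [List.getD_eq_getElem?_getD, j.isLt]
  rw [h3] at h2
  exact absurd (lintegral_word_true_cons_eq_top (List.ofFn fun j : Fin n => ε j.succ) n) h2.ne
/-- Integrability is invariant under duality (Jacobian formula for the involution). [folklore] -/
theorem integrableOn_wordFun_iff_dual (ε : Fin w → Bool) (q : ℚ) :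
    IntegrableOn (wordFun ε q) (simplex w) volume ↔
      IntegrableOn (wordFun (dualWord ε) q) (simplex w) volume := by
  have h := integrableOn_image_iff_integrableOn_abs_det_fderiv_smul volume (measurableSet_simplex w)
    (fun x _ => (hasFDerivAt_dualMap x).hasFDerivWithinAt) injOn_dualMap (wordFun ε q)
  rw [image_dualMap_simplex] at h
  rw [h]
  refine integrableOn_congr_fun (fun x _ => ?_) (measurableSet_simplex w)
  rw [abs_det_dualLin, one_smul, ← wordFun_dualWord_dualMap (dualWord ε) q x, dualWord_dualWord]

/-- A word of positive length is non-admissible iff it starts with `1` or ends with `0`. [folklore] -/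
theorem not_adm_iff {n : ℕ} (ε : Fin (n + 1) → Bool) :
    ¬ Adm ε ↔ ε 0 = true ∨ ε (Fin.last n) = false := by
  have e : (⟨n + 1 - 1, Nat.sub_one_lt_of_lt (Nat.succ_pos n)⟩ : Fin (n + 1)) = Fin.last n :=
    Fin.ext (by simp)
  constructor
  · intro h
    by_cases h0 : ε 0 = true
    · exact Or.inl h0
    · right
      by_contra h1
      apply h
      intro _
      refine ⟨by simpa using h0, ?_⟩
      rw [e]
      simpa using h1
  · rintro (h | h) hA
    · have := (hA (Nat.succ_pos n)).1
      simp_all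
    · have := (hA (Nat.succ_pos n)).2
      rw [e] at this
      simp_all

/-- **NON-ADMISSIBLE WORDS HAVE NO REPRESENTATION**: for `¬ Adm ε` and `q ≠ 0` the word integrand
is not absolutely integrable on the simplex. [folklore] -/
theorem not_integrableOn_wordFun {ε : Fin w → Bool} (hε : ¬ Adm ε) {q : ℚ} (hq : q ≠ 0) :
    ¬ IntegrableOn (wordFun ε q) (simplex w) volume := by
  obtain ⟨n, rfl⟩ : ∃ n, w = n + 1 := by
    cases w with
    | zero => exact absurd (fun h => absurd h (lt_irrefl 0)) hε
    | succ n => exact ⟨n, rfl⟩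
  rcases (not_adm_iff ε).mp hε with h | h
  · exact not_integrableOn_wordFun_of_head ε h hq
  · rw [integrableOn_wordFun_iff_dual]
    refine not_integrableOn_wordFun_of_head (dualWord ε) ?_ hq
    simp [dualWord, Fin.rev_zero, h]

/-- Hence a generator of the crux with non-admissible letters has `q = 0` … [folklore] -/
theorem eq_zero_of_not_adm {ε : Fin w → Bool} {q : ℚ} (s : KZ.IntegralRep w)
    (hd : s.domain = simplex w) (hi : EqOn s.integrand (wordFun ε q) s.domain) (hε : ¬ Adm ε) :
    q = 0 := by
  by_contra hq
  refine not_integrableOn_wordFun hε hq ?_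
  have h := s.integrableOn.congr_fun hi (KZ.IntegralRep.measurableSet_domain_holds s)
  rwa [hd] at h

/-- … and is therefore a relation (zero integrand on the domain). [folklore] -/
theorem of_mem_relations_of_not_adm {ε : Fin w → Bool} {q : ℚ} (s : KZ.IntegralRep w)
    (hd : s.domain = simplex w) (hi : EqOn s.integrand (wordFun ε q) s.domain) (hε : ¬ Adm ε) :
    KZ.of s ∈ KZ.relations := by
  have hq := eq_zero_of_not_adm s hd hi hε
  subst hq
  exact of_mem_relations_of_eqOn_zero s fun t ht => by simp [hi ht, wordFun]

/-- Every element of the full weight-`w` closure is congruent to one of the admissible closure. [folklore] -/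
theorem exists_adm_congr {c : KZ.FormalRep} (hc : c ∈ AddSubgroup.closure (genSetW w)) :
    ∃ c' ∈ AddSubgroup.closure (genSetAdm w), c - c' ∈ KZ.relations := by
  induction hc using AddSubgroup.closure_induction with
  | mem x hx =>
    obtain ⟨ε, q, s, hd, hi, rfl⟩ := hx
    by_cases hε : Adm ε
    · exact ⟨KZ.of s, AddSubgroup.subset_closure ⟨ε, q, s, hε, hd, hi, rfl⟩, by simp⟩
    · exact ⟨0, zero_mem _, by simpa using of_mem_relations_of_not_adm s hd hi hε⟩
  | zero => exact ⟨0, zero_mem _, by simp⟩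
  | add x y _ _ ihx ihy =>
    obtain ⟨c₁, h₁, e₁⟩ := ihx
    obtain ⟨c₂, h₂, e₂⟩ := ihy
    refine ⟨c₁ + c₂, add_mem h₁ h₂, ?_⟩
    have : x + y - (c₁ + c₂) = (x - c₁) + (y - c₂) := by abel
    rw [this]
    exact add_mem e₁ e₂
  | neg x _ ih =>
    obtain ⟨c', h', e'⟩ := ih
    refine ⟨-c', neg_mem h', ?_⟩
    have : -x - -c' = -(x - c') := by abel
    rw [this]
    exact neg_mem e'

/-- **`WeightKernel w ↔ WeightKernelAdm w`**: the cards' rung IS the admissible rung. [folklore] -/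
theorem weightKernel_iff_weightKernelAdm : WeightKernel w ↔ WeightKernelAdm w := by
  refine ⟨weightKernelAdm_of_weightKernel, fun h c hc hc0 => ?_⟩
  obtain ⟨c', hc', e⟩ := exists_adm_congr hc
  have hev : KZ.eval c' = 0 := by
    have := (AddMonoidHom.mem_ker).1 (KZ.relations_le_ker_eval_holds e)
    rwa [map_sub, hc0, zero_sub, neg_eq_zero] at this
  have := add_mem e (h c' hc' hev)
  simpa using this

/-- So the weight-3 rung holds for the cards' `WeightKernel 3` verbatim, and `WeightKernel 4` is
exactly the two typed memberships. [folklore] -/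
theorem weightKernel_three : WeightKernel 3 :=
  weightKernel_iff_weightKernelAdm.mpr weightKernelAdm_three

/-- **The weight-2 rung `WeightKernel 2` holds** unconditionally. [folklore] -/
theorem weightKernel_two : WeightKernel 2 :=
  weightKernel_iff_weightKernelAdm.mpr weightKernelAdm_two

/-- **`WeightKernel 4` ⟺ the two typed memberships `cFds4`, `cEuler4`** (duality being one move and non-admissible words carrying no representation). [folklore] -/
theorem weightKernel_four_iff : WeightKernel 4 ↔ cFds4 ∈ KZ.relations ∧ cEuler4 ∈ KZ.relations :=
  weightKernel_iff_weightKernelAdm.trans weightKernelAdm_four_iff_two_targets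

end Divergence

end Summit.KontsevichZagierPeriods.MzvKernelInKZ.Negative
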